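import Literature.NumberTheory.EllipticCurves.Kato2004.ZetaClassOnRankLeOneBranch
import Summits.BirchSwinnertonDyer.BirchSwinnertonDyer.Theorems.UniversalToricDescentSigmaEulerMuZero
import HarnessLib

/-!
# The Kato multiplier `M̃` is `p`-primitive in the (semi-)diagonal gauge — PORT 1/2 of ideator g66's kernel
# (`Cruxes/EllipticUnitValueSevenOfGZK/MuFreeMultiplierSeven_g66.lean`, tree sha16 66d29e3b022a13de, §1–§4 = l.74–358,
# inlined as §0.1–§0.4 of g68 `RealisationAssemblySeven_g68.lean` d2c3fb8381c0379f) to a BUILT home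

Crux `stmt-BirchSwinnertonDyer-19945` (K7r), the (E2)-PORT (cell `bsd-cm` vote V-E2 D962, pen ruling D973 (c); seat
`bsd-cm-prr-ty1` g32).  Crux workfiles under `Cruxes/` are not built on the farm and are barred as imports (D841), so the
kernel lemmas the (E2) glue needs are re-homed here, statements and proofs VERBATIM (only the namespace changes, to
`Summit.BirchSwinnertonDyer.Rank1Residual.Additive.MuFreeMultiplier`):

* §1 images of `(1+T)^x` in `𝔽_p⟦T⟧ = Λ/pΛ` (`ne_zero_of_constantCoeff_eq_one`, `constantCoeff_map_onePlusTPow`,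
  `map_onePlusTPow_ne_one`, `natCast_dvd_iff_C_dvd`);
* §2 the three factor lemmas in the domain `𝔽_p⟦T⟧` (`linearFactor_ne_zero`, `twoTermFactor_ne_zero`, `eulerFactor_ne_zero`);
* §3 `p ∤ M̃` in the semi-diagonal and diagonal gauges, no hypothesis on `a_ℓ, ε_ℓ`
  (`not_C_p_dvd_katoMultiplier_semidiag/_diag`, `katoMultiplier_semidiag_not_mem_augIdealP`);
* §4 exponents from the cyclotomic tower and the `Ψ`-keyed theorem in the letter of the body
  (`toAdd_ne_zero_of_isCyclotomic(_prime)`, `not_natCast_dvd_katoMultiplier_psi_of_isCyclotomic`).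

Port 2/2 (`RamifiedSevenMuFreeDiagonalGauge.lean`) carries §5–§6 (★ `exists_diagonalGauge`, ★★ `muFree_conjunct_of_diagonalGauge`).
Theorems only; no `def`, no instance, no notation, no `sorry`; imports exactly g66's.  HONEST LABEL: kernel algebra about
`katoMultiplier`; nothing here proves (E2), the crux, or any summit statement; BSD is claimed for no curve.

[cite: Kato2004Asterisque, Lemma 13.10 (1) (p. 230), §13.9 (p. 229), Thm. 6.6 (1) (pp. 162–163)] [cite: Washington1997, §7.2 and Ch. 13]
-/

set_option autoImplicit false

noncomputable section

open scoped Classical MatrixGroups ModularForm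
open CongruenceSubgroup PowerSeries Field
open Literature.NumberTheory.EllipticCurves Literature.NumberTheory.EllipticCurves.Kato2004
  Literature.NumberTheory.EllipticCurves.IwasawaCharacter Literature.NumberTheory.GaloisRepresentations
open Summit.BirchSwinnertonDyer.Rank1Residual.X11b.SigmaEulerMu

namespace Summit.BirchSwinnertonDyer.Rank1Residual.Additive.MuFreeMultiplier

variable {p : ℕ} [hp : Fact p.Prime]

/-! ## §1 Images of `(1+T)^x` in `𝔽_p⟦T⟧ = Λ/pΛ` (any prime `p`) -/

section Images

/-- A power series over `𝔽_p` with constant coefficient `1` is non-zero. [folklore] -/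
theorem ne_zero_of_constantCoeff_eq_one {F : PowerSeries (ZMod p)} (h : PowerSeries.constantCoeff F = 1) : F ≠ 0 := by
  intro hF
  rw [hF, map_zero] at h
  exact zero_ne_one h

/-- The image of `(1+T)^x` in `𝔽_p⟦T⟧` has constant coefficient `1`. [cite: Washington1997, §7.2] -/
theorem constantCoeff_map_onePlusTPow (x : ℤ_[p]) :
    PowerSeries.constantCoeff
      (PowerSeries.map (PadicInt.toZMod (p := p)) (onePlusTPow p ℤ_[p] x : IwasawaAlgebra p)) = 1 := by
  rw [← PowerSeries.coeff_zero_eq_constantCoeff_apply, PowerSeries.coeff_map, val_onePlusTPow,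
    PowerSeries.coeff_zero_eq_constantCoeff_apply, PowerSeries.binomialSeries_constantCoeff, map_one]

/-- **`(1+T)^x ≢ 1 (mod p)` for `x ≠ 0`**, read in `𝔽_p⟦T⟧` (the tree's Lucas-free lemma
`SigmaEulerMu.not_C_p_dvd_onePlusTPow_sub_one`). [cite: Washington1997, §7.2 and §13.1] -/
theorem map_onePlusTPow_ne_one {x : ℤ_[p]} (hx : x ≠ 0) :
    PowerSeries.map (PadicInt.toZMod (p := p)) (onePlusTPow p ℤ_[p] x : IwasawaAlgebra p) ≠ 1 := by
  intro h
  apply not_C_p_dvd_onePlusTPow_sub_one (p := p) hx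
  rw [C_p_dvd_iff_map_toZMod_eq_zero, map_sub, map_one, h, sub_self]

/-- `(p : Λ) = C p`: the natural-number cast and the constant agree, so `(p : Λ) ∣ F ↔ C p ∣ F`. [folklore] -/
theorem natCast_dvd_iff_C_dvd (F : IwasawaAlgebra p) :
    (p : IwasawaAlgebra p) ∣ F ↔ (PowerSeries.C (p : ℤ_[p]) : IwasawaAlgebra p) ∣ F := by
  rw [map_natCast]

end Images

/-! ## §2 The three factor lemmas in the domain `𝔽_p⟦T⟧` -/

section Factors

/-- **Linear factor**: `d̄ − v ≠ 0` in `𝔽_p⟦T⟧` for `v` with constant coefficient `1` and `v ≠ 1` (if `v = d̄` is a constant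
with constant coefficient `1` then `v = 1`). [cite: Kato2004Asterisque, §13.9 (p. 229)] [cite: Washington1997, §7.2] -/
theorem linearFactor_ne_zero {v : PowerSeries (ZMod p)} (hv0 : PowerSeries.constantCoeff v = 1) (hv : v ≠ 1) (d : ℤ) :
    (d : PowerSeries (ZMod p)) - v ≠ 0 := by
  intro h
  have hvd : v = (d : PowerSeries (ZMod p)) := (sub_eq_zero.mp h).symm
  have hd1 : ((d : ℤ) : ZMod p) = 1 := by
    have h' := congrArg PowerSeries.constantCoeff hvd
    rwa [hv0, map_intCast, eq_comm] at h'
  apply hv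
  rw [hvd, ← map_intCast (PowerSeries.C (R := ZMod p)) d, hd1, map_one]

/-- **Two-term factor**: `c̄ n̄₁ − n̄₂ u ≠ 0` in `𝔽_p⟦T⟧` for `u` with constant coefficient `1`, `u ≠ 1`, `c̄ ≠ 0`, unless
`n̄₁ = n̄₂ = 0`: constant coefficients give `n̄₂ = c̄ n̄₁`, then `n̄₂ (u − 1) = 0` in a domain.
[cite: Kato2004Asterisque, Lemma 13.10 (1) (p. 230)] [cite: Washington1997, §7.2, §13.1] -/
theorem twoTermFactor_ne_zero {u : PowerSeries (ZMod p)} (hu0 : PowerSeries.constantCoeff u = 1) (hu : u ≠ 1)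
    {c n₁ n₂ : ℤ} (hc : ((c : ℤ) : ZMod p) ≠ 0) (hn : ¬ (((n₁ : ℤ) : ZMod p) = 0 ∧ ((n₂ : ℤ) : ZMod p) = 0)) :
    (c : PowerSeries (ZMod p)) * (n₁ : PowerSeries (ZMod p)) - (n₂ : PowerSeries (ZMod p)) * u ≠ 0 := by
  intro h
  have heq : (n₂ : PowerSeries (ZMod p)) * u = (c : PowerSeries (ZMod p)) * (n₁ : PowerSeries (ZMod p)) :=
    (sub_eq_zero.mp h).symm
  -- constant coefficients: `n̄₂ = c̄ n̄₁`
  have h0 : ((n₂ : ℤ) : ZMod p) = ((c : ℤ) : ZMod p) * ((n₁ : ℤ) : ZMod p) := by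
    have h' := congrArg PowerSeries.constantCoeff heq
    rwa [map_mul, map_mul, map_intCast, map_intCast, map_intCast, hu0, mul_one] at h'
  by_cases hn₂ : ((n₂ : ℤ) : ZMod p) = 0
  · -- then `c̄ n̄₁ = 0`, so `n̄₁ = 0`: excluded
    have hn₁ : ((n₁ : ℤ) : ZMod p) = 0 := by
      rw [hn₂, eq_comm, mul_eq_zero] at h0
      exact h0.resolve_left hc
    exact hn ⟨hn₁, hn₂⟩
  · -- `n̄₂ u = n̄₂`, so `u = 1`
    have hC : (n₂ : PowerSeries (ZMod p)) * u = (n₂ : PowerSeries (ZMod p)) := by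
      rw [heq, ← map_intCast (PowerSeries.C (R := ZMod p)) c, ← map_intCast (PowerSeries.C (R := ZMod p)) n₁,
        ← map_intCast (PowerSeries.C (R := ZMod p)) n₂, ← map_mul, ← h0]
    have hn₂C : (n₂ : PowerSeries (ZMod p)) ≠ 0 := by
      rw [← map_intCast (PowerSeries.C (R := ZMod p)) n₂]
      intro h0'
      apply hn₂
      have := congrArg PowerSeries.constantCoeff h0'
      rwa [PowerSeries.constantCoeff_C, map_zero] at this
    apply hu
    have h1 : (n₂ : PowerSeries (ZMod p)) * (u - 1) = 0 := by rw [mul_sub, mul_one, hC, sub_self]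
    exact sub_eq_zero.mp ((mul_eq_zero.mp h1).resolve_left hn₂C)

/-- **Kato's Euler factor mod `p` does not vanish**: in `𝔽_p⟦T⟧`, for `w` with constant coefficient `1`, `w ≠ 1` (the image of
`Ψ_ℓ`, `κ(σ_ℓ) ≠ 0`) and `ℓ̄ ≠ 0` (`ℓ ≠ p`): `ℓ̄² w² − (ā ℓ̄) w + ε̄ ℓ̄ ≠ 0` — with `w = 1 + δ`, `δ ≠ 0`, `δ ≡ 0 (mod T)`, it equals
`(ℓ̄² − āℓ̄ + ε̄ℓ̄) + δ((2ℓ̄² − āℓ̄) + ℓ̄²δ)`; reading constant coefficients twice leaves `ℓ̄² δ = 0`.  NO hypothesis on the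
Dirichlet coefficient `a_ℓ` or on `ε_ℓ`. [cite: Kato2004Asterisque, §13.9 (p. 229), Ex. 13.3 (p. 225)] [cite: Washington1997, §7.2] -/
theorem eulerFactor_ne_zero {w : PowerSeries (ZMod p)} (hw0 : PowerSeries.constantCoeff w = 1) (hw : w ≠ 1)
    {ℓ : ℕ} (hℓ : ((ℓ : ℕ) : ZMod p) ≠ 0) (a e : ℤ) :
    ((ℓ ^ 2 : ℕ) : PowerSeries (ZMod p)) * w ^ 2 - ((a * ℓ : ℤ) : PowerSeries (ZMod p)) * w +
      ((e * ℓ : ℤ) : PowerSeries (ZMod p)) ≠ 0 := by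
  set δ : PowerSeries (ZMod p) := w - 1 with hδ
  have hδ0 : δ ≠ 0 := fun h => hw (sub_eq_zero.mp h)
  have hδc : PowerSeries.constantCoeff δ = 0 := by rw [hδ, map_sub, hw0, map_one, sub_self]
  have hw1 : w = 1 + δ := by rw [hδ]; ring
  -- name the three constants
  set L : PowerSeries (ZMod p) := PowerSeries.C (((ℓ : ℕ) : ZMod p) ^ 2) with hL
  set A : PowerSeries (ZMod p) := PowerSeries.C (((a : ℤ) : ZMod p) * ((ℓ : ℕ) : ZMod p)) with hA
  set B : PowerSeries (ZMod p) := PowerSeries.C (((e : ℤ) : ZMod p) * ((ℓ : ℕ) : ZMod p)) with hB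
  have hLc : ((ℓ ^ 2 : ℕ) : PowerSeries (ZMod p)) = L := by
    rw [hL, map_pow, map_natCast, Nat.cast_pow]
  have hAc : ((a * ℓ : ℤ) : PowerSeries (ZMod p)) = A := by
    rw [hA, map_mul, map_intCast, map_natCast]; push_cast; ring
  have hBc : ((e * ℓ : ℤ) : PowerSeries (ZMod p)) = B := by
    rw [hB, map_mul, map_intCast, map_natCast]; push_cast; ring
  rw [hLc, hAc, hBc, hw1]
  have hG : L * (1 + δ) ^ 2 - A * (1 + δ) + B = (L - A + B) + δ * ((2 * L - A) + L * δ) := by ring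
  rw [hG]
  intro h
  -- constant coefficients: `ℓ̄² − āℓ̄ + ε̄ℓ̄ = 0`
  have h0 : PowerSeries.constantCoeff (L - A + B) = 0 := by
    have h' := congrArg PowerSeries.constantCoeff h
    rwa [map_add, map_mul, hδc, zero_mul, add_zero, map_zero] at h'
  have hconst : L - A + B = 0 := by
    rw [hL, hA, hB, ← map_sub, ← map_add] at h0 ⊢
    rw [PowerSeries.constantCoeff_C] at h0
    rw [h0, map_zero]
  rw [hconst, zero_add] at h
  have h1 : (2 * L - A) + L * δ = 0 := (mul_eq_zero.mp h).resolve_left hδ0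
  -- constant coefficients again: `2ℓ̄² − āℓ̄ = 0`
  have h1c : PowerSeries.constantCoeff (2 * L - A) = 0 := by
    have h' := congrArg PowerSeries.constantCoeff h1
    rwa [map_add, map_mul, hδc, mul_zero, add_zero, map_zero] at h'
  have hlin : 2 * L - A = 0 := by
    rw [hL, hA, ← map_ofNat (PowerSeries.C (R := ZMod p)) 2, ← map_mul, ← map_sub] at h1c ⊢
    rw [PowerSeries.constantCoeff_C] at h1c
    rw [h1c, map_zero]
  rw [hlin, zero_add] at h1
  -- `ℓ̄² δ = 0` with `δ ≠ 0`: so `ℓ̄² = 0`, contradiction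
  have hL0 : L = 0 := (mul_eq_zero.mp h1).resolve_right hδ0
  have hℓ2 : ((ℓ : ℕ) : ZMod p) ^ 2 = 0 := by
    have h' := congrArg PowerSeries.constantCoeff hL0
    rwa [hL, PowerSeries.constantCoeff_C, map_zero] at h'
  exact hℓ (pow_eq_zero_iff (n := 2) two_ne_zero |>.mp hℓ2)

end Factors

/-! ## §3 `p ∤ M̃` in the semi-diagonal and diagonal gauges (any prime `p`; no hypothesis on `a_ℓ, ε_ℓ`) -/

section Multiplier

/-- **`p ∤ M̃` in the SEMI-DIAGONAL gauge `n₃ = n₁, n₄ = n₂` (`d′ = 1`).** For integers `c, d` prime to `p`, cusp coordinates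
with NOT (`p ∣ n₁` and `p ∣ n₂`), exponents `x, y ≠ 0` of `Ψ_c = (1+T)^x`, `Ψ_d = (1+T)^y`, and a finite set `E` of naturals
prime to `p` with exponents `e ℓ ≠ 0`: the four-cusp factor reduces in `𝔽_p⟦T⟧` to `c̄ d̄ (d̄ − v)(c̄ n̄₁ − n̄₂ u)` and each Euler
factor to `ℓ̄²w² − āℓ̄w + ε̄ℓ̄`, none of which vanishes (§2); so `C p ∤ katoMultiplier p c d n₁ n₂ n₁ n₂ …`.
[cite: Kato2004Asterisque, Thm. 6.6 (1) (p. 163), Lemma 13.10 (1) (p. 230), §13.12 (p. 231)] [cite: Washington1997, §13.1] -/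
theorem not_C_p_dvd_katoMultiplier_semidiag {c d : ℤ} (hc : ¬ (p : ℤ) ∣ c) (hd : ¬ (p : ℤ) ∣ d) {n₁ n₂ : ℤ}
    (hn : ¬ ((p : ℤ) ∣ n₁ ∧ (p : ℤ) ∣ n₂)) {x y : ℤ_[p]} (hx : x ≠ 0) (hy : y ≠ 0)
    (E : Finset ℕ) (aℓ εℓ : ℕ → ℤ) {e : ℕ → ℤ_[p]} (hE : ∀ ℓ ∈ E, ¬ (p ∣ ℓ) ∧ e ℓ ≠ 0) :
    ¬ (PowerSeries.C (p : ℤ_[p]) : IwasawaAlgebra p) ∣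
      katoMultiplier p c d n₁ n₂ n₁ n₂ (onePlusTPow p ℤ_[p] x : IwasawaAlgebra p)
        (onePlusTPow p ℤ_[p] y : IwasawaAlgebra p) E aℓ εℓ
        (fun ℓ => (onePlusTPow p ℤ_[p] (e ℓ) : IwasawaAlgebra p)) := by
  rw [C_p_dvd_iff_map_toZMod_eq_zero]
  have hcz : ((c : ℤ) : ZMod p) ≠ 0 := fun h => hc ((ZMod.intCast_zmod_eq_zero_iff_dvd c p).mp h)
  have hdz : ((d : ℤ) : ZMod p) ≠ 0 := fun h => hd ((ZMod.intCast_zmod_eq_zero_iff_dvd d p).mp h)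
  have hnz : ¬ (((n₁ : ℤ) : ZMod p) = 0 ∧ ((n₂ : ℤ) : ZMod p) = 0) := fun h =>
    hn ⟨(ZMod.intCast_zmod_eq_zero_iff_dvd n₁ p).mp h.1, (ZMod.intCast_zmod_eq_zero_iff_dvd n₂ p).mp h.2⟩
  have hcC : (c : PowerSeries (ZMod p)) ≠ 0 := by
    rw [← map_intCast (PowerSeries.C (R := ZMod p)) c]
    intro h; apply hcz
    have := congrArg PowerSeries.constantCoeff h
    rwa [PowerSeries.constantCoeff_C, map_zero] at this
  have hdC : (d : PowerSeries (ZMod p)) ≠ 0 := by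
    rw [← map_intCast (PowerSeries.C (R := ZMod p)) d]
    intro h; apply hdz
    have := congrArg PowerSeries.constantCoeff h
    rwa [PowerSeries.constantCoeff_C, map_zero] at this
  set u := PowerSeries.map (PadicInt.toZMod (p := p)) (onePlusTPow p ℤ_[p] x : IwasawaAlgebra p) with hu
  set v := PowerSeries.map (PadicInt.toZMod (p := p)) (onePlusTPow p ℤ_[p] y : IwasawaAlgebra p) with hv
  unfold katoMultiplier
  rw [map_mul]
  refine mul_ne_zero ?_ ?_
  · -- the four-cusp factor: `c̄ d̄ (d̄ − v)(c̄ n̄₁ − n̄₂ u)`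
    rw [map_add, map_sub, map_sub, map_mul, map_mul, map_mul, map_mul, map_intCast, map_intCast, map_intCast,
      map_intCast, ← hu, ← hv]
    have key : ((c ^ 2 * d ^ 2 * n₁ : ℤ) : PowerSeries (ZMod p)) - ((c * d ^ 2 * n₂ : ℤ) : PowerSeries (ZMod p)) * u -
        ((c ^ 2 * d * n₁ : ℤ) : PowerSeries (ZMod p)) * v + ((c * d * n₂ : ℤ) : PowerSeries (ZMod p)) * u * v =
        ((c : PowerSeries (ZMod p)) * (d : PowerSeries (ZMod p))) *
          (((d : PowerSeries (ZMod p)) - v) *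
            ((c : PowerSeries (ZMod p)) * (n₁ : PowerSeries (ZMod p)) - (n₂ : PowerSeries (ZMod p)) * u)) := by
      push_cast; ring
    rw [key]
    exact mul_ne_zero (mul_ne_zero hcC hdC)
      (mul_ne_zero (linearFactor_ne_zero (constantCoeff_map_onePlusTPow y) (map_onePlusTPow_ne_one hy) d)
        (twoTermFactor_ne_zero (constantCoeff_map_onePlusTPow x) (map_onePlusTPow_ne_one hx) hcz hnz))
  · -- each Euler factor: `ℓ̄² w² − ā ℓ̄ w + ε̄ ℓ̄`
    rw [map_prod, Finset.prod_ne_zero_iff]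
    intro ℓ hℓ
    obtain ⟨hpℓ, heℓ⟩ := hE ℓ hℓ
    have hℓz : ((ℓ : ℕ) : ZMod p) ≠ 0 := fun h => hpℓ ((ZMod.natCast_eq_zero_iff ℓ p).mp h)
    rw [map_add, map_sub, map_mul, map_mul, map_pow, map_natCast, map_intCast, map_intCast]
    exact eulerFactor_ne_zero (constantCoeff_map_onePlusTPow (e ℓ)) (map_onePlusTPow_ne_one heℓ) hℓz (aℓ ℓ) (εℓ ℓ)

/-- **`p ∤ M̃` in the DIAGONAL gauge `n₁ = n₂ = n₃ = n₄ = n`** (`c ≡ d₁ ≡ 1 (mod A)`, `d′ = 1`): the case `p ∤ n` of the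
semi-diagonal theorem; the four-cusp factor is `n·c d (c − Ψ_c)(d − Ψ_d)`.
[cite: Kato2004Asterisque, Lemma 13.10 (1) (p. 230), §13.12 (p. 231)] -/
theorem not_C_p_dvd_katoMultiplier_diag {c d : ℤ} (hc : ¬ (p : ℤ) ∣ c) (hd : ¬ (p : ℤ) ∣ d) {n : ℤ}
    (hn : ¬ (p : ℤ) ∣ n) {x y : ℤ_[p]} (hx : x ≠ 0) (hy : y ≠ 0)
    (E : Finset ℕ) (aℓ εℓ : ℕ → ℤ) {e : ℕ → ℤ_[p]} (hE : ∀ ℓ ∈ E, ¬ (p ∣ ℓ) ∧ e ℓ ≠ 0) :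
    ¬ (PowerSeries.C (p : ℤ_[p]) : IwasawaAlgebra p) ∣
      katoMultiplier p c d n n n n (onePlusTPow p ℤ_[p] x : IwasawaAlgebra p)
        (onePlusTPow p ℤ_[p] y : IwasawaAlgebra p) E aℓ εℓ
        (fun ℓ => (onePlusTPow p ℤ_[p] (e ℓ) : IwasawaAlgebra p)) :=
  not_C_p_dvd_katoMultiplier_semidiag hc hd (fun h => hn h.1) hx hy E aℓ εℓ hE

/-- Currency `M̃ ∉ (p) = IwasawaAlgebra.augIdealP p` (semi-diagonal gauge). [cite: Kato2004Asterisque, §13.12 (p. 231)] -/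
theorem katoMultiplier_semidiag_not_mem_augIdealP {c d : ℤ} (hc : ¬ (p : ℤ) ∣ c) (hd : ¬ (p : ℤ) ∣ d) {n₁ n₂ : ℤ}
    (hn : ¬ ((p : ℤ) ∣ n₁ ∧ (p : ℤ) ∣ n₂)) {x y : ℤ_[p]} (hx : x ≠ 0) (hy : y ≠ 0)
    (E : Finset ℕ) (aℓ εℓ : ℕ → ℤ) {e : ℕ → ℤ_[p]} (hE : ∀ ℓ ∈ E, ¬ (p ∣ ℓ) ∧ e ℓ ≠ 0) :
    katoMultiplier p c d n₁ n₂ n₁ n₂ (onePlusTPow p ℤ_[p] x : IwasawaAlgebra p)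
        (onePlusTPow p ℤ_[p] y : IwasawaAlgebra p) E aℓ εℓ
        (fun ℓ => (onePlusTPow p ℤ_[p] (e ℓ) : IwasawaAlgebra p)) ∉ IwasawaAlgebra.augIdealP p := by
  rw [IwasawaAlgebra.augIdealP, Ideal.mem_span_singleton]
  exact not_C_p_dvd_katoMultiplier_semidiag hc hd hn hx hy E aℓ εℓ hE

end Multiplier

/-! ## §4 Exponents from the cyclotomic tower, and the `Ψ`-keyed theorem in the letter of the body -/

section Cyclotomic

/-- **In the CYCLOTOMIC `ℤ_p`-extension, `σ` with `χ_cyc(σ) = c ∈ ℤ`, `c ≠ ±1`, has `κ(σ) ≠ 0`.**  `κ(σ) = 0` means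
`σ ∈ ker κ = χ_cyc⁻¹(μ(ℤ_p))` (`ZpExtension.IsCyclotomic`), so `c^m = 1` in `ℤ_p`, hence in `ℤ`, for some `m ≥ 1`: `c = ±1`.
[cite: Washington1997, §13.1 (p. 264)] [cite: GreenbergLNM1716, §1] -/
theorem toAdd_ne_zero_of_isCyclotomic {K : ZpExtension ℚ p} (hK : K.IsCyclotomic) {σ : absoluteGaloisGroup ℚ} {c : ℤ}
    (hσ : ((GaloisRep.cyclotomicCharacter ℚ p σ : ℤ_[p]ˣ) : ℤ_[p]) = c) (h1 : c ≠ 1) (h1' : c ≠ -1) :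
    (K σ).toAdd ≠ 0 := by
  intro h0
  have hker : σ ∈ K.kerSubgroup := by
    rw [ZpExtension.mem_kerSubgroup, ← ofAdd_toAdd (K σ), h0, ofAdd_zero]
  rw [hK, Subgroup.mem_comap, CommGroup.mem_torsion, isOfFinOrder_iff_pow_eq_one] at hker
  obtain ⟨m, hm, hpow⟩ := hker
  have hpow₁ : (GaloisRep.cyclotomicCharacter ℚ p σ : ℤ_[p]ˣ) ^ m = 1 := hpow
  have hpow' : ((GaloisRep.cyclotomicCharacter ℚ p σ : ℤ_[p]ˣ) : ℤ_[p]) ^ m = 1 := by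
    rw [← Units.val_pow_eq_pow_val, hpow₁, Units.val_one]
  rw [hσ] at hpow'
  have hcm : c ^ m = 1 := by exact_mod_cast hpow'
  rcases Int.isUnit_iff.mp (IsUnit.of_pow_eq_one hcm hm.ne') with h | h
  exacts [h1 h, h1' h]

/-- For a prime `ℓ ≠ p` and `σ` with `χ_cyc(σ) = ℓ` in the cyclotomic tower: `κ(σ) ≠ 0` (`ℓ ≠ ±1`).
[cite: Washington1997, §13.1 (p. 264)] -/
theorem toAdd_ne_zero_of_isCyclotomic_prime {K : ZpExtension ℚ p} (hK : K.IsCyclotomic) {σ : absoluteGaloisGroup ℚ}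
    {ℓ : ℕ} (hℓ : ℓ.Prime) (hσ : ((GaloisRep.cyclotomicCharacter ℚ p σ : ℤ_[p]ˣ) : ℤ_[p]) = ℓ) :
    (K σ).toAdd ≠ 0 := by
  refine toAdd_ne_zero_of_isCyclotomic hK (c := (ℓ : ℤ)) (by rw [hσ, Int.cast_natCast]) ?_ ?_
  · exact_mod_cast hℓ.ne_one
  · have : (0 : ℤ) ≤ (ℓ : ℤ) := Int.natCast_nonneg ℓ
    omega

/-- **The `Ψ`-KEYED theorem in the letter of the μ-free clause of `HasMuFreeRealisedZetaFamilyBody`** (semi-diagonal gauge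
`n₃ = n₁, n₄ = n₂`): for the cyclotomic `ℤ_p`-extension `K`, Galois elements with `χ_cyc(σ_c) = c`, `χ_cyc(σ_{d₁}) = d₁`,
`χ_cyc(σ_ℓ) = ℓ` on `A.primeFactors.erase p`, integers `c, d₁ ∉ pℤ ∪ {±1}`, and NOT (`p ∣ n₁ ∧ p ∣ n₂`):
`¬ (p : Λ) ∣ katoMultiplier p c d₁ n₁ n₂ n₁ n₂ Ψ(σ_c) Ψ(σ_{d₁}) (A.primeFactors.erase p) a_• ε_• Ψ(σ_•)` — for ANY `a_•, ε_•`.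
[cite: Kato2004Asterisque, Lemma 13.10 (1) (p. 230), §13.12 (p. 231)] [cite: Castella2018, §2.1–2.2 (pp. 4–5)] -/
theorem not_natCast_dvd_katoMultiplier_psi_of_isCyclotomic (K : ZpExtension ℚ p) (hK : K.IsCyclotomic)
    {c d₁ : ℤ} (hc : ¬ (p : ℤ) ∣ c) (hd : ¬ (p : ℤ) ∣ d₁) (hc1 : c ≠ 1) (hc1' : c ≠ -1) (hd1 : d₁ ≠ 1) (hd1' : d₁ ≠ -1)
    {n₁ n₂ : ℤ} (hn : ¬ ((p : ℤ) ∣ n₁ ∧ (p : ℤ) ∣ n₂))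
    {σc σd : absoluteGaloisGroup ℚ} {σℓ : ℕ → absoluteGaloisGroup ℚ}
    (hσc : ((GaloisRep.cyclotomicCharacter ℚ p σc : ℤ_[p]ˣ) : ℤ_[p]) = c)
    (hσd : ((GaloisRep.cyclotomicCharacter ℚ p σd : ℤ_[p]ˣ) : ℤ_[p]) = d₁) {A : ℕ}
    (hσℓ : ∀ ℓ ∈ A.primeFactors.erase p, ((GaloisRep.cyclotomicCharacter ℚ p (σℓ ℓ) : ℤ_[p]ˣ) : ℤ_[p]) = ℓ)
    (aℓ εℓ : ℕ → ℤ) :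
    ¬ ((p : IwasawaAlgebra p) ∣
      katoMultiplier p c d₁ n₁ n₂ n₁ n₂
        ((IwasawaCharacter.Psi p ℤ_[p] K σc : (PowerSeries ℤ_[p])ˣ) : IwasawaAlgebra p)
        ((IwasawaCharacter.Psi p ℤ_[p] K σd : (PowerSeries ℤ_[p])ˣ) : IwasawaAlgebra p)
        (A.primeFactors.erase p) aℓ εℓ
        (fun ℓ => ((IwasawaCharacter.Psi p ℤ_[p] K (σℓ ℓ) : (PowerSeries ℤ_[p])ˣ) : IwasawaAlgebra p))) := by
  rw [natCast_dvd_iff_C_dvd]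
  simp only [IwasawaCharacter.Psi_apply]
  refine not_C_p_dvd_katoMultiplier_semidiag hc hd hn (toAdd_ne_zero_of_isCyclotomic hK hσc hc1 hc1')
    (toAdd_ne_zero_of_isCyclotomic hK hσd hd1 hd1') (A.primeFactors.erase p) aℓ εℓ (e := fun ℓ => (K (σℓ ℓ)).toAdd) ?_
  intro ℓ hℓ
  have hℓp : ℓ ≠ p := Finset.ne_of_mem_erase hℓ
  have hℓprime : ℓ.Prime := Nat.prime_of_mem_primeFactors (Finset.mem_of_mem_erase hℓ)
  refine ⟨fun hdvd => hℓp ((Nat.prime_dvd_prime_iff_eq hp.out hℓprime).mp hdvd).symm, ?_⟩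
  exact toAdd_ne_zero_of_isCyclotomic_prime hK hℓprime (hσℓ ℓ hℓ)

end Cyclotomic

end Summit.BirchSwinnertonDyer.Rank1Residual.Additive.MuFreeMultiplier

end
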